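import Literature.Geometry.ComplexAnalytic.BoundarySingularityB2Recognition
import Literature.Analysis.Complex.WeierstrassPreparation
import HarnessLib

/-!
# An even holomorphic function of order four: Weierstrass preparation lands on `B₂`
# (`f = (u⁴ + λ₁u² + λ₂)·unit`, and zero is a critical value of `f(μ, ·)` iff `(λ₁, λ₂) ∈ Σ(B₂)`)

Family `hodge`, layer `Literature/Geometry/ComplexAnalytic`, sequel of `BoundarySingularityB2Bifurcation` (the level
bifurcation set `Σ(B₂) = {λ₂ = 0} ∪ {4λ₂ = λ₁²}` of the boundary singularity `B₂` and its `ℤ₂`-symmetric double cover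
`F̂ = ŷ⁴ + λ₁ŷ² + λ₂`, AGZV II §5.2) and `BoundarySingularityB2Recognition` (an even monic quartic IS some `F̂(·, λ)`),
using the tree's parametric Weierstrass preparation theorem `Analysis/Complex/WeierstrassPreparation` (Chirka §1.1).
Written by the prover seat `hodge-nonav-19716-p2` (g8, cell `hodge-nonav`) for programme B2-BIF (the bifurcation half
`IsSymmetricA3Bifurcation` of the binder hB2 `picardLefschetz_symmetricA3` of crux K1-B of
`Summits/HodgeConjecture/HodgeConjecture/Theses/SignSymmetricPowers.lean`, stmt-HodgeConjecture-19716): the REDUCED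
FUNCTION `r((α, β), u)` of the symmetric `A₃` unfolding (AGZV II §5.2: the `ℤ₂`-invariant function on the double cover
after elimination of the non-degenerate variables) is holomorphic near `0`, EVEN in `u` and of order `4` in `u` at the
origin; this file turns exactly those three properties into the `B₂` picture, CHART-FREE:

* `analyticOrderAt_neg_of_even` — for `g` holomorphic on a disc around `0` with `g(-w) = g(w)`, the orders of vanishing
  at `a` and `-a` agree;
* `exists_even_quartic_preparation` — for `f : (ℂ × ℂ) × ℂ → ℂ` holomorphic near `0`, even in the last variable, with
  `ord_{u=0} f(0, ·) = 4`: on a polydisc `|μ| < ε, |u| < ρ` one has `f(μ, u) = (u⁴ + λ₁(μ)u² + λ₂(μ))·U(μ, u)` with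
  `U` holomorphic and zero-free, `λ₁, λ₂` holomorphic, `λ₁(0) = λ₂(0) = 0`, and all roots of `u⁴ + λ₁(μ)u² + λ₂(μ)` in
  the disc `|u| < ρ` (Weierstrass preparation; the root multiset of an even slice is symmetric, so the Weierstrass
  polynomial is an even monic quartic, i.e. `F̂(·, (λ₁, λ₂))` by `exists_eq_hatB₂_of_eval_neg`);
* `exists_critical_zero_iff` — in that situation, for `|μ| < ε`: `f(μ, ·)` has a zero `u`, `|u| < ρ`, which is also a
  critical point iff `λ₂(μ) = 0 ∨ 4λ₂(μ) = λ₁(μ)²`, i.e. `(λ₁, λ₂)(μ) ∈ Σ(B₂)` (`exists_critical_hatB₂_iff`).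

## References
* [ArnoldGuseinzadeVarchenko2012] V. I. Arnold, S. M. Gusein-Zade, A. N. Varchenko, *Singularities of Differentiable
  Maps, Volume 2*, Birkhäuser 2012, Part I §5.2 (boundary singularities; the double cover `V̂_ε`; the level bifurcation
  set of `B_k`, pp. 129–133 of the held text, fig. 48).
* [Chirka1989] E. M. Chirka, *Complex Analytic Sets*, Kluwer 1989, §1.1 (Weierstrass preparation theorem, p. 3–4).
-/

noncomputable section

open Polynomial Metric Set Filter Complex
open scoped Topology
open Literature.Analysis.Complex Literature.Analysis.Complex.SCV

namespace Literature.Geometry.ComplexAnalytic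

namespace BoundarySingularity

/-! ### The order of vanishing of an even function at `a` and `-a` -/

/-- **Even functions vanish to the same order at `a` and `-a`.**  For `g` holomorphic on the disc `|w| < R` with
`g(-w) = g(w)` there, and `a` in the disc at which the order of `g` is finite: `ord_{-a} g = ord_a g` (if
`g(z) = (z - a)ⁿ φ(z)` near `a` then `g(z) = g(-z) = (z + a)ⁿ · (-1)ⁿ φ(-z)` near `-a`).
[cite: ArnoldGuseinzadeVarchenko2012, Part I §5.2 (the `ℤ₂`-invariant function `f̂`)] -/
theorem analyticOrderAt_neg_of_even {g : ℂ → ℂ} {R : ℝ} (hg : DifferentiableOn ℂ g (ball 0 R))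
    (hev : ∀ w ∈ ball (0 : ℂ) R, g (-w) = g w) {a : ℂ} (ha : a ∈ ball (0 : ℂ) R) (hfin : analyticOrderAt g a ≠ ⊤) :
    analyticOrderAt g (-a) = analyticOrderAt g a := by
  have han : AnalyticOnNhd ℂ g (ball 0 R) := hg.analyticOnNhd isOpen_ball
  have hna : -a ∈ ball (0 : ℂ) R := by simpa using ha
  obtain ⟨m, hm⟩ := ENat.ne_top_iff_exists.1 hfin
  rw [← hm]
  obtain ⟨φ, hφ, hφa, hev'⟩ := ((han a ha).analyticOrderAt_eq_natCast).1 hm.symm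
  refine ((han (-a) hna).analyticOrderAt_eq_natCast).2 ⟨fun z => (-1) ^ m * φ (-z), ?_, ?_, ?_⟩
  · exact analyticAt_const.mul (hφ.comp_of_eq (analyticAt_id.neg) (by simp))
  · simpa using hφa
  · have ht : Tendsto (fun z : ℂ => -z) (𝓝 (-a)) (𝓝 a) := by
      simpa using (continuous_neg.tendsto (-a))
    have h1 : ∀ᶠ z in 𝓝 (-a), g (-z) = (-z - a) ^ m • φ (-z) := ht.eventually hev'
    have h2 : ∀ᶠ z in 𝓝 (-a), z ∈ ball (0 : ℂ) R := isOpen_ball.mem_nhds hna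
    filter_upwards [h1, h2] with z hz1 hz2
    rw [← hev z hz2, hz1, smul_eq_mul, smul_eq_mul]
    have : (-z - a) = -(z - -a) := by ring
    rw [this, neg_pow]
    ring

/-! ### Weierstrass preparation of an even function of order four -/

/-- **Even holomorphic functions of order four are `(u⁴ + λ₁u² + λ₂) × unit`.**  Let `f : (ℂ × ℂ) × ℂ → ℂ` be
holomorphic on an open `Ω ∋ 0`, EVEN in the last variable on `Ω` (`(μ, -u) ∈ Ω` and `f(μ, -u) = f(μ, u)`), with
`ord_{u = 0} f(0, ·) = 4`.  Then there are `ε, ρ > 0` with `{|μ| < ε} × {|u| < ρ} ⊆ Ω`, functions `λ₁, λ₂` holomorphic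
on `|μ| < ε` vanishing at `0`, and `U` holomorphic and zero-free on the polydisc, such that
`f(μ, u) = (u⁴ + λ₁(μ)u² + λ₂(μ))·U(μ, u)` there, and for `|μ| < ε` every root of `u⁴ + λ₁(μ)u² + λ₂(μ)` has
`|u| < ρ`.  (Weierstrass preparation, Chirka §1.1; the root multiset of the even slice `f(μ, ·)` is symmetric under
`u ↦ -u` by `analyticOrderAt_neg_of_even`, so the Weierstrass polynomial is an even monic quartic — AGZV's `F̂(·, λ)`
by `exists_eq_hatB₂_of_eval_neg`.) [cite: ArnoldGuseinzadeVarchenko2012, Part I §5.2 (held text chunk p0132)]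
[cite: Chirka1989, §1.1 Thm., p. 3] -/
theorem exists_even_quartic_preparation {f : (ℂ × ℂ) × ℂ → ℂ} {Ω : Set ((ℂ × ℂ) × ℂ)} (hΩ : IsOpen Ω)
    (h0 : ((0 : ℂ × ℂ), (0 : ℂ)) ∈ Ω) (hf : DifferentiableOn ℂ f Ω)
    (heven : ∀ p ∈ Ω, (p.1, -p.2) ∈ Ω ∧ f (p.1, -p.2) = f p)
    (hord : analyticOrderAt (fun u => f (0, u)) 0 = 4) :
    ∃ (ε ρ : ℝ) (l₁ l₂ : ℂ × ℂ → ℂ) (U : (ℂ × ℂ) × ℂ → ℂ), 0 < ε ∧ 0 < ρ ∧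
      ball (0 : ℂ × ℂ) ε ×ˢ ball (0 : ℂ) ρ ⊆ Ω ∧
      DifferentiableOn ℂ l₁ (ball 0 ε) ∧ DifferentiableOn ℂ l₂ (ball 0 ε) ∧ l₁ 0 = 0 ∧ l₂ 0 = 0 ∧
      DifferentiableOn ℂ U (ball (0 : ℂ × ℂ) ε ×ˢ ball (0 : ℂ) ρ) ∧
      (∀ p ∈ ball (0 : ℂ × ℂ) ε ×ˢ ball (0 : ℂ) ρ, U p ≠ 0) ∧
      (∀ p ∈ ball (0 : ℂ × ℂ) ε ×ˢ ball (0 : ℂ) ρ, f p = (p.2 ^ 4 + l₁ p.1 * p.2 ^ 2 + l₂ p.1) * U p) ∧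
      (∀ μ ∈ ball (0 : ℂ × ℂ) ε, ∀ u : ℂ, u ^ 4 + l₁ μ * u ^ 2 + l₂ μ = 0 → u ∈ ball (0 : ℂ) ρ) := by
  classical
  -- the base slice is not identically zero near `0`
  have hne : ¬ (fun w => f (0, w)) =ᶠ[𝓝 0] 0 := by
    intro h
    have htop : analyticOrderAt (fun u => f (0, u)) 0 = ⊤ := analyticOrderAt_eq_top.2 h
    rw [hord] at htop
    exact ENat.coe_ne_top 4 htop
  obtain ⟨ε, ρ, R, hε, hsub, hW, -, hbase⟩ := exists_weierstrassData hΩ hf h0 hne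
  have hbase4 : sliceRoots f 0 ρ 0 = Multiset.replicate 4 0 := by
    rw [hbase]
    simp [analyticOrderNatAt, hord]
  obtain ⟨hcard, hesymm, -, hUd, hUne, hfact⟩ :=
    hW.weierstrass_preparation (convex_ball (0 : ℂ × ℂ) ε).isPreconnected (mem_ball_self hε)
  have hcard4 : ∀ μ ∈ ball (0 : ℂ × ℂ) ε, (sliceRoots f 0 ρ μ).card = 4 := fun μ hμ => by
    rw [hcard μ hμ, hbase4, Multiset.card_replicate]
  -- the root multiset of an even slice is symmetric
  have hsymm : ∀ μ ∈ ball (0 : ℂ × ℂ) ε, (sliceRoots f 0 ρ μ).map Neg.neg = sliceRoots f 0 ρ μ := by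
    intro μ hμ
    have hgd : DifferentiableOn ℂ (fun w => f (μ, w)) (ball 0 R) := hW.differentiableOn_slice hμ
    have hgev : ∀ w ∈ ball (0 : ℂ) R, f (μ, -w) = f (μ, w) := fun w hw =>
      (heven (μ, w) (hsub (mk_mem_prod hμ hw))).2
    have hsph : ∀ w ∈ sphere (0 : ℂ) ρ, f (μ, w) ≠ 0 := hW.ne_zero μ hμ
    ext b
    rw [show b = -(-b) from (neg_neg b).symm, Multiset.count_map_eq_count' _ _ neg_injective, neg_neg]
    by_cases hb : b ∈ ball (0 : ℂ) ρ
    · have hnb : -b ∈ ball (0 : ℂ) ρ := by simpa using hb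
      rw [sliceRoots, count_rootMultiset_of_mem_ball hgd hW.pos hW.lt hsph hnb,
        count_rootMultiset_of_mem_ball hgd hW.pos hW.lt hsph hb, analyticOrderNatAt, analyticOrderNatAt,
        analyticOrderAt_neg_of_even hgd hgev (ball_subset_ball hW.lt.le hb)
          (analyticOrderAt_ne_top_of_sphere hgd hW.pos hW.lt hsph (ball_subset_ball hW.lt.le hb))]
    · have hnb : -b ∉ ball (0 : ℂ) ρ := fun h => hb (by simpa using h)
      have h1 : Multiset.count (-b) (sliceRoots f 0 ρ μ) = 0 :=
        Multiset.count_eq_zero.2 fun h => hnb (mem_ball_of_mem_rootMultiset h)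
      have h2 : Multiset.count b (sliceRoots f 0 ρ μ) = 0 :=
        Multiset.count_eq_zero.2 fun h => hb (mem_ball_of_mem_rootMultiset h)
      rw [h1, h2]
  -- the Weierstrass polynomial as a polynomial, and its evenness
  let P : ℂ × ℂ → ℂ[X] := fun μ => ((sliceRoots f 0 ρ μ).map fun a => X - C a).prod
  have hPeval : ∀ μ u, (P μ).eval u = weierstrassFun f 0 ρ (μ, u) := by
    intro μ u
    simp only [P, weierstrassFun, Polynomial.eval_multiset_prod, Multiset.map_map, Function.comp_def,
      Polynomial.eval_sub, Polynomial.eval_X, Polynomial.eval_C]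
  have hPmonic : ∀ μ, (P μ).Monic := fun μ =>
    monic_multiset_prod_of_monic _ _ fun a _ => monic_X_sub_C a
  have hPdeg : ∀ μ ∈ ball (0 : ℂ × ℂ) ε, (P μ).natDegree = 4 := fun μ hμ => by
    simp only [P]
    rw [natDegree_multiset_prod_X_sub_C_eq_card, hcard4 μ hμ]
  have hPeven : ∀ μ ∈ ball (0 : ℂ × ℂ) ε, ∀ y : ℂ, (P μ).eval (-y) = (P μ).eval y := by
    intro μ hμ y
    have h1 : (P μ).eval (-y) =
        ((((sliceRoots f 0 ρ μ).map Neg.neg).map fun b => y - b).map Neg.neg).prod := by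
      simp only [P, Polynomial.eval_multiset_prod, Multiset.map_map, Function.comp_def, Polynomial.eval_sub,
        Polynomial.eval_X, Polynomial.eval_C]
      congr 1
      exact Multiset.map_congr rfl fun a _ => by ring
    rw [h1, Multiset.prod_map_neg, Multiset.card_map, Multiset.card_map, hcard4 μ hμ, hsymm μ hμ]
    simp only [P, Polynomial.eval_multiset_prod, Multiset.map_map, Function.comp_def, Polynomial.eval_sub,
      Polynomial.eval_X, Polynomial.eval_C]
    norm_num
  -- hence it is `F̂(·, (λ₁, λ₂))` with `λ₁ = coeff 2 = e₂`, `λ₂ = coeff 0 = e₄`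
  let l₁ : ℂ × ℂ → ℂ := fun μ => (P μ).coeff 2
  let l₂ : ℂ × ℂ → ℂ := fun μ => (P μ).coeff 0
  have hPhat : ∀ μ ∈ ball (0 : ℂ × ℂ) ε, P μ = hatB₂ ![l₁ μ, l₂ μ] := by
    intro μ hμ
    obtain ⟨l, hl⟩ := exists_eq_hatB₂_of_eval_neg (P μ) (hPmonic μ) (hPdeg μ hμ) (hPeven μ hμ)
    have hl0 : l₁ μ = l 0 := by
      show (P μ).coeff 2 = l 0
      rw [hl, hatB₂]; simp
    have hl1 : l₂ μ = l 1 := by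
      show (P μ).coeff 0 = l 1
      rw [hl, hatB₂]; simp
    rw [hl, hl0, hl1]
    congr
    funext i
    fin_cases i <;> rfl
  have hWeval : ∀ μ ∈ ball (0 : ℂ × ℂ) ε, ∀ u,
      weierstrassFun f 0 ρ (μ, u) = u ^ 4 + l₁ μ * u ^ 2 + l₂ μ := by
    intro μ hμ u
    rw [← hPeval, hPhat μ hμ, eval_hatB₂_eq]
    rfl
  have hl₁e : ∀ μ ∈ ball (0 : ℂ × ℂ) ε, l₁ μ = (sliceRoots f 0 ρ μ).esymm 2 := by
    intro μ hμ
    show (P μ).coeff 2 = _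
    simp only [P]
    rw [Multiset.prod_X_sub_C_coeff _ (by rw [hcard4 μ hμ]; norm_num), hcard4 μ hμ]
    norm_num
  have hl₂e : ∀ μ ∈ ball (0 : ℂ × ℂ) ε, l₂ μ = (sliceRoots f 0 ρ μ).esymm 4 := by
    intro μ hμ
    show (P μ).coeff 0 = _
    simp only [P]
    rw [Multiset.prod_X_sub_C_coeff _ (by rw [hcard4 μ hμ]; norm_num), hcard4 μ hμ]
    norm_num
  have hP0 : P 0 = X ^ 4 := by
    simp only [P]
    rw [hbase4, Multiset.map_replicate, Multiset.prod_replicate, map_zero, sub_zero]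
  refine ⟨ε, ρ, l₁, l₂, weierstrassUnit f 0 ρ, hε, hW.pos,
    (Set.prod_mono Subset.rfl (ball_subset_ball hW.lt.le)).trans hsub, ?_, ?_, ?_, ?_, hUd, hUne, ?_, ?_⟩
  · exact (hesymm 2).congr fun μ hμ => hl₁e μ hμ
  · exact (hesymm 4).congr fun μ hμ => hl₂e μ hμ
  · show (P 0).coeff 2 = 0
    rw [hP0, Polynomial.coeff_X_pow]; norm_num
  · show (P 0).coeff 0 = 0
    rw [hP0, Polynomial.coeff_X_pow]; norm_num
  · intro p hp
    rw [hfact p hp, hWeval p.1 hp.1 p.2]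
  · intro μ hμ u hu
    have h0 : weierstrassFun f 0 ρ (μ, u) = 0 := by rw [hWeval μ hμ, hu]
    rw [weierstrassFun_eq_zero_iff] at h0
    exact mem_ball_of_mem_rootMultiset h0

/-! ### Zero is a critical value of `f(μ, ·)` iff `(λ₁, λ₂)(μ) ∈ Σ(B₂)` -/

/-- **Critical zeros of `(u⁴ + λ₁u² + λ₂)·unit` are read off `Σ(B₂)`.**  If on the polydisc `|μ| < ε, |u| < ρ` one has
`f(μ, u) = (u⁴ + λ₁(μ)u² + λ₂(μ))·U(μ, u)` with `U` holomorphic and zero-free, and all roots of the quartic lie in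
`|u| < ρ`, then for `|μ| < ε`: there is `u`, `|u| < ρ`, with `f(μ, u) = 0 = ∂ᵤf(μ, u)` iff
`λ₂(μ) = 0 ∨ 4λ₂(μ) = λ₁(μ)²` ("the condition `λ ∈ Σ` is equivalent to: zero is a critical value of `F̂(·, λ)`",
`exists_critical_hatB₂_iff`). [cite: ArnoldGuseinzadeVarchenko2012, Part I §5.2 (held text chunks p0132–p0133, fig. 48)] -/
theorem exists_critical_zero_iff {f : (ℂ × ℂ) × ℂ → ℂ} {ε ρ : ℝ} {l₁ l₂ : ℂ × ℂ → ℂ} {U : (ℂ × ℂ) × ℂ → ℂ}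
    (hUd : DifferentiableOn ℂ U (ball (0 : ℂ × ℂ) ε ×ˢ ball (0 : ℂ) ρ))
    (hUne : ∀ p ∈ ball (0 : ℂ × ℂ) ε ×ˢ ball (0 : ℂ) ρ, U p ≠ 0)
    (hfact : ∀ p ∈ ball (0 : ℂ × ℂ) ε ×ˢ ball (0 : ℂ) ρ, f p = (p.2 ^ 4 + l₁ p.1 * p.2 ^ 2 + l₂ p.1) * U p)
    (hroots : ∀ μ ∈ ball (0 : ℂ × ℂ) ε, ∀ u : ℂ, u ^ 4 + l₁ μ * u ^ 2 + l₂ μ = 0 → u ∈ ball (0 : ℂ) ρ)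
    {μ : ℂ × ℂ} (hμ : μ ∈ ball (0 : ℂ × ℂ) ε) :
    (∃ u ∈ ball (0 : ℂ) ρ, f (μ, u) = 0 ∧ deriv (fun u => f (μ, u)) u = 0) ↔
      (l₂ μ = 0 ∨ 4 * l₂ μ = l₁ μ ^ 2) := by
  set Q : ℂ[X] := hatB₂ ![l₁ μ, l₂ μ] with hQ
  have hQeval : ∀ u, Q.eval u = u ^ 4 + l₁ μ * u ^ 2 + l₂ μ := fun u => by
    rw [hQ, eval_hatB₂_eq]; rfl
  -- the derivative of `f(μ, ·)` at a point of the disc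
  have hderiv : ∀ u ∈ ball (0 : ℂ) ρ, ∃ U' : ℂ,
      deriv (fun u => f (μ, u)) u = (derivative Q).eval u * U (μ, u) + Q.eval u * U' := by
    intro u hu
    have hUat : DifferentiableAt ℂ (fun v => U (μ, v)) u := by
      have h1 : DifferentiableAt ℂ U (μ, u) :=
        hUd.differentiableAt ((isOpen_ball.prod isOpen_ball).mem_nhds (mk_mem_prod hμ hu))
      exact h1.comp u ((differentiableAt_const μ).prodMk differentiableAt_id)
    refine ⟨deriv (fun v => U (μ, v)) u, ?_⟩
    have hev : (fun v => f (μ, v)) =ᶠ[𝓝 u] fun v => Q.eval v * U (μ, v) := by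
      filter_upwards [isOpen_ball.mem_nhds hu] with v hv
      rw [hfact (μ, v) (mk_mem_prod hμ hv), hQeval]
    rw [hev.deriv_eq]
    have h := (Q.hasDerivAt u).mul hUat.hasDerivAt
    show deriv ((fun x => eval x Q) * fun v => U (μ, v)) u = _
    rw [h.deriv]
  constructor
  · rintro ⟨u, hu, hf0, hf1⟩
    have hU0 : U (μ, u) ≠ 0 := hUne (μ, u) (mk_mem_prod hμ hu)
    have hQ0 : Q.eval u = 0 := by
      rw [hfact (μ, u) (mk_mem_prod hμ hu), ← hQeval] at hf0
      exact (mul_eq_zero.1 hf0).resolve_right hU0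
    obtain ⟨U', hU'⟩ := hderiv u hu
    have hQ1 : (derivative Q).eval u = 0 := by
      rw [hU', hQ0, zero_mul, add_zero] at hf1
      exact (mul_eq_zero.1 hf1).resolve_right hU0
    have h := (exists_critical_hatB₂_iff ![l₁ μ, l₂ μ]).1 ⟨u, hQ0, hQ1⟩
    rw [mem_levelBifurcationSetB_two_iff] at h
    simpa using h
  · intro h
    have h' : (![l₁ μ, l₂ μ] : Fin 2 → ℂ) ∈ levelBifurcationSetB 2 := by
      rw [mem_levelBifurcationSetB_two_iff]; simpa using h
    obtain ⟨u, hQ0, hQ1⟩ := (exists_critical_hatB₂_iff ![l₁ μ, l₂ μ]).2 h'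
    have hu : u ∈ ball (0 : ℂ) ρ := hroots μ hμ u (by rw [← hQeval]; exact hQ0)
    obtain ⟨U', hU'⟩ := hderiv u hu
    refine ⟨u, hu, ?_, ?_⟩
    · rw [hfact (μ, u) (mk_mem_prod hμ hu), ← hQeval, hQ0, zero_mul]
    · rw [hU', hQ0, hQ1, zero_mul, zero_mul, add_zero]

end BoundarySingularity

end Literature.Geometry.ComplexAnalytic

end
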